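import Mathlib
import Summits.NavierStokesRegularity.NavierStokesRegularity.Theorems.TypeIQuarterGateScarEnvelopeTypeISatelliteTowerChainLimit
import Summits.NavierStokesRegularity.NavierStokesRegularity.Theorems.TypeIQuarterGateScarEnvelopeTypeISatelliteTowerGalleryNormalForm
import Summits.NavierStokesRegularity.NavierStokesRegularity.Theorems.TypeIQuarterGateScarEnvelopeTypeISatelliteTowerGallerySaturation

/-!
# Satellite tower for crux `ScarEnvelopeTypeI` (stmt-NavierStokesRegularity-23843) — Part X: THE SELF-DESCENDING FIXED POINT in the minimal family; no sup-type Lyapunov functional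

Part X of nsreg-p3's ROUND-42 artefact (section `FixedPoint`), joining the census with ns-sz-p1 g6's gallery modules BY NAME
(`…SatelliteTowerGalleryNormalForm` p653175 `fixedPointNormalForm`, `…SatelliteTowerGallerySaturation`): X1 ★★★ `DoublyMin.galleryLimit_rep` (every
gallery limit of a doubly-minimal object has a DOUBLY-MINIMAL A–B representative a.e.); X2 ★★★ `DoublyMin.selfDescending_rep` (enveloped rooted object of
class `M_c(I)` ∨ a SELF-DESCENDING root-recurrent node with a doubly-minimal representative, root and 1/4-satellite exactly `M_c(I)`-rated and
energy-saturated); X3 ★★★ `selfDescending_doublyMin_of_not_scarEnvelopeTypeI` (fixed-point census of ¬23843); X4 ★★ `DoublyMin.noStrictLyapunov` /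
`DoublyMin.noStrictLyapunov_wild` (no sup-type Lyapunov functional: every blow-up-monotone functional is constant along root blow-ups of its minimisers).

PROVENANCE: declaration texts VERBATIM from the HOME artefact of the instrument seat nsreg-p3 g27 (cell `pub/ns-regularity-ideate`):
`round-42/Chain42.lean` (sha16 `8681f04ed429667a`, NEW parts `partW.lean` ed7e536880a3af23 / `partX.lean` f60de1ac17788f57; a module written
against the TREE; memo `round-42/ROUND-42.md` 5522927bd2abf3bc), scored by referee ref3 g27 (`SCORE-p3-ROUND-42-0828.md`); the author cannot write under `Theorems/`
(`perm.theorems-prover-only`); landed by the prover ns-es-p1 g5 as landing hand of record (director-ns DIRECTOR-NS #237 (3)), split into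
≤ 400-line modules, `E3` spelled out, the artefact's `#guard_msgs … #print axioms` certificates not landed.
`--supports stmt-NavierStokesRegularity-23843 --as helper`.

HONEST FRAMING: instrument theorems about HYPOTHETICAL Type-I zoom limits (Albritton–Barker objects of the census of crux
`TypeIQuarterGate.ScarEnvelopeTypeI`, item 23843); the analytic input is the tree's closure engine (compactness
`local_typeI_compactness_twin_inBall`, sharpened to constant 1 in Part S1; Q1 whole-space), P1 rate inheritance, L8 persistence and the
tree's PROVED small-constant Liouville theorem; Parts R/S are order theory on the re-classing and closure lemmas.  NOTHING OPEN IS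
PROVED: 23843, (L′) `TypeILiouvilleAB` / (L′₀), the GLOBAL (S∞) = `CritAttained`, (M𝐈₁), (E1⁺), (E2ᵣ), route ExtremalTypeIConstant's
cruxes, N0 and Navier–Stokes regularity are OPEN; `critRate`, `levelCrit I`, `liouvilleRate` are `sInf`s that are `0` by junk value
when the defining set is empty (every statement using them carries the nonemptiness hypothesis explicitly).
-/

-- the summit-side namespace repeats a component by design (single-conjunct summit, D-0017)
set_option linter.dupNamespace false

open MeasureTheory Set Metric Filter Topology
open scoped ENNReal NNReal InnerProductSpace
open Literature.Analysis.FluidPDE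

namespace Summit.NavierStokesRegularity.NavierStokesRegularity.Cruxes.ScarEnvelopeTypeI.ZoomDictionary

section FixedPoint

variable {U : ℝ → (EuclideanSpace ℝ (Fin 3)) → (EuclideanSpace ℝ (Fin 3))} {P : ℝ → (EuclideanSpace ℝ (Fin 3)) → ℝ}

/-- ★★★ **X1. EVERY GALLERY LIMIT OF A DOUBLY-MINIMAL OBJECT HAS A DOUBLY-MINIMAL REPRESENTATIVE.**  If
`W` is a gallery limit of the field of a doubly-minimal object `n₀` of the level `I` (an `L³_loc` limit
of zooms of `n₀.U` with free final-time centres and arbitrary positive scales), then there is an A–B datum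
`(U', P', H')` of the class `M_c(I)` with `U' = W` a.e. on every `Q_R(0)`, the same scars as `W`, slab
energy `≤ minLevel I`; if `W` is singular at the root, `⟨U', P', H', y⟩` is DOUBLY MINIMAL of the level
`I` for every recorded point `y`.  (Every zoom of `n₀` is an A–B object of the class `M_c(I)` with slab
energy EXACTLY `𝐈(n₀) = minLevel I` by scale and translation invariance; W0 along the zooms; the two
`L³(Q_R(0))` limits agree a.e., `ae_eq_of_tendsto_eLpNorm_three`; scars transfer by `regPt_congr_ae`.) -/
theorem DoublyMin.galleryLimit_rep {I : ℝ≥0∞} {n₀ : TNode} (h : DoublyMin I n₀) {W : ℝ → (EuclideanSpace ℝ (Fin 3)) → (EuclideanSpace ℝ (Fin 3))}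
    (hW : IsGalleryLimit n₀.U W) :
    ∃ (U' : ℝ → (EuclideanSpace ℝ (Fin 3)) → (EuclideanSpace ℝ (Fin 3))) (P' : ℝ → (EuclideanSpace ℝ (Fin 3)) → ℝ) (H' : ℝ → (EuclideanSpace ℝ (Fin 3)) → (EuclideanSpace ℝ (Fin 3)) →L[ℝ] (EuclideanSpace ℝ (Fin 3))),
      ABTower (levelCrit I) U' P' H' ∧ typeIBound (Iio (0 : ℝ) ×ˢ univ) U' P' H' ≤ minLevel I ∧
      (∀ R : ℝ, 0 < R →
        ∀ᵐ z ∂(volume.restrict (parabolicCylinder R (0 : ℝ × (EuclideanSpace ℝ (Fin 3))))), U' z.1 z.2 = W z.1 z.2) ∧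
      (∀ y : (EuclideanSpace ℝ (Fin 3)), RegPt U' y ↔ RegPt W y) ∧
      (¬ RegPt W 0 → ∀ y : (EuclideanSpace ℝ (Fin 3)), DoublyMin I ⟨U', P', H', y⟩) := by
  obtain ⟨hW3, x, l, hl, hconvW⟩ := hW
  have hT : ABTower (levelCrit I) n₀.U n₀.P n₀.H := h.1.1.1
  have hmin_lt : minLevel I < ⊤ := by
    rw [← h.2]
    exact hT.2.2.2
  have hminI : minLevel I ≤ I := by
    rw [← h.2]
    exact h.1.2
  -- the zooms: A–B objects of the same class and the same slab energy
  have hABk : ∀ k, ABTower (levelCrit I) (zoom n₀.U (x k) 0 (l k)) (zoomP n₀.P (x k) 0 (l k))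
      (l k ^ 2 • stPull (l k ^ 2) (l k) (0 : ℝ) (x k) n₀.H) := fun k => by
    rw [zoom_eq_smul_stPull, zoomP_eq_smul_stPull]
    exact abTower_zoom hT (x k) (hl k)
  have hbdk : ∀ k, typeIBound (Iio (0 : ℝ) ×ˢ univ) (zoom n₀.U (x k) 0 (l k))
      (zoomP n₀.P (x k) 0 (l k)) (l k ^ 2 • stPull (l k ^ 2) (l k) (0 : ℝ) (x k) n₀.H) ≤ minLevel I := by
    intro k
    rw [← h.2]
    show _ ≤ typeIBound (Iio (0 : ℝ) ×ˢ univ) n₀.U n₀.P n₀.H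
    rw [zoom_eq_smul_stPull, zoomP_eq_smul_stPull,
      ← typeIBound_nsZoom (hl k) (0 : ℝ) (x k) (Iio (0 : ℝ) ×ˢ univ) n₀.U n₀.P n₀.H,
      stAffine_preimage_lowerSlab (hl k) (x k)]
  -- W0 along the zooms (constant class `M_c(I)`, constant bound `minLevel I`)
  obtain ⟨U', P', H', σ, hσ, hAB, hle, -, -, hconv, -⟩ :=
    abSeq_closed''' hmin_lt _ _ _ hABk hbdk (tendsto_const_nhds (x := levelCrit I))
  -- the two `L³(Q_R(0))` limits agree a.e.
  have hae : ∀ R : ℝ, 0 < R →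
      ∀ᵐ z ∂(volume.restrict (parabolicCylinder R (0 : ℝ × (EuclideanSpace ℝ (Fin 3))))), U' z.1 z.2 = W z.1 z.2 := by
    intro R hR
    have h1 := ae_eq_of_tendsto_eLpNorm_three
      (μ := volume.restrict (parabolicCylinder R (0 : ℝ × (EuclideanSpace ℝ (Fin 3)))))
      (f := fun j => Function.uncurry (zoom n₀.U (x (σ j)) 0 (l (σ j))))
      (fun j => (hABk (σ j)).aestronglyMeasurable_uncurry hR) (hAB.aestronglyMeasurable_uncurry hR)
      (hW3 R hR).1 (hconv R hR) ((hconvW R hR).comp hσ.tendsto_atTop)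
    exact h1.mono fun w hw => hw
  have hreg : ∀ y : (EuclideanSpace ℝ (Fin 3)), RegPt U' y ↔ RegPt W y := fun y =>
    ⟨fun hr => regPt_congr_ae (R := ‖y‖ + 1) (by linarith [norm_nonneg y])
        ((hae _ (by positivity)).mono fun z hz => hz) hr,
     fun hr => regPt_congr_ae (R := ‖y‖ + 1) (by linarith [norm_nonneg y])
        ((hae _ (by positivity)).mono fun z hz => hz.symm) hr⟩
  refine ⟨U', P', H', hAB, hle, hae, hreg, fun h0 y => ?_⟩
  have hEx : ExactCrit I ⟨U', P', H', y⟩ := ⟨⟨hAB, fun hr => h0 ((hreg 0).1 hr)⟩, hle.trans hminI⟩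
  exact ⟨hEx, le_antisymm hle (minLevel_le hEx)⟩

/-- ★★★ **X2. THE SELF-DESCENDING FIXED POINT IS DOUBLY MINIMAL (ref3 R41 F2, through X1).**  For every
doubly-minimal object `n₀` of the level `I`: EITHER an enveloped rooted A–B object of the class `M_c(I)`
exists, OR there is a SELF-DESCENDING node `n` — `RootObj (M_c I) n`, non-tame, `RootDescends n n` (its
field is a tangent flow of ITSELF at its own root, with a satellite on the sphere `‖y‖ = 1/4`), a root
ω-limit of itself and a gallery limit of `n₀` (LEAD sz-p1 g6's `ABTower.envelopedLeaf_or_selfDescending`,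
by name) — TOGETHER WITH a DOUBLY-MINIMAL A–B representative `(U', P', H')` of the level `I` agreeing with
`n.U` a.e. on the open past, with the same scars; in it the root AND the `1/4`-satellite (and every other
scar of `n`) are rated EXACTLY `M_c(I)` and ENERGY-SATURATED, `𝐈(Q_ρ((0, y'))) = minLevel I` for every
`ρ > 0`; and the gallery-minimal rate `m⋆` of the fixed point IS `M_c(I)`. -/
theorem DoublyMin.selfDescending_rep {I : ℝ≥0∞} {n₀ : TNode} (h : DoublyMin I n₀) :
    (∃ A : ℝ, EnvelopedLeaf (levelCrit I) A) ∨
    ∃ (n : TNode) (U' : ℝ → (EuclideanSpace ℝ (Fin 3)) → (EuclideanSpace ℝ (Fin 3))) (P' : ℝ → (EuclideanSpace ℝ (Fin 3)) → ℝ) (H' : ℝ → (EuclideanSpace ℝ (Fin 3)) → (EuclideanSpace ℝ (Fin 3)) →L[ℝ] (EuclideanSpace ℝ (Fin 3))),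
      RootObj (levelCrit I) n ∧ ¬ TameRoot n ∧ RootDescends n n ∧ IsRootOmegaLimit n.U n.U ∧
      IsGalleryLimit n₀.U n.U ∧
      (∀ R : ℝ, 0 < R →
        ∀ᵐ z ∂(volume.restrict (parabolicCylinder R (0 : ℝ × (EuclideanSpace ℝ (Fin 3))))), U' z.1 z.2 = n.U z.1 z.2) ∧
      DoublyMin I ⟨U', P', H', n.y⟩ ∧ (∀ y : (EuclideanSpace ℝ (Fin 3)), RegPt U' y ↔ RegPt n.U y) ∧
      ‖n.y‖ = 1 / 4 ∧ ¬ RegPt U' 0 ∧ ¬ RegPt U' n.y ∧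
      (∀ y' : (EuclideanSpace ℝ (Fin 3)), ¬ RegPt n.U y' → tightRate U' y' = levelCrit I ∧
        ∀ ρ : ℝ, 0 < ρ →
          typeIBound (parabolicCylinder ρ (((0 : ℝ), y') : ℝ × (EuclideanSpace ℝ (Fin 3)))) U' P' H' = minLevel I) ∧
      (∃ mstar : ℝ, ABTower mstar n.U n.P n.H ∧
        (∀ y : (EuclideanSpace ℝ (Fin 3)), ¬ RegPt n.U y → tightRate n.U y = mstar) ∧ mstar = levelCrit I) := by
  have hT : ABTower (levelCrit I) n₀.U n₀.P n₀.H := h.1.1.1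
  rcases hT.envelopedLeaf_or_selfDescending h.1.1.2 with hE |
      ⟨n, hn, ht, hd, hgal, -, hω, mstar, hm, -, hsc, -⟩
  · exact Or.inl hE
  right
  obtain ⟨U', P', H', hAB, hle, hae, hreg, hDM⟩ := h.galleryLimit_rep hgal
  have hD : DoublyMin I ⟨U', P', H', n.y⟩ := hDM hn.2 n.y
  obtain ⟨L, Ū, hLU, haeU, hny, hsat⟩ := hd
  have h0' : ¬ RegPt U' 0 := fun hr => hn.2 ((hreg 0).1 hr)
  have hy' : ¬ RegPt U' n.y := fun hr => hsat.2 ((hreg n.y).1 hr)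
  have hsc' : ∀ y' : (EuclideanSpace ℝ (Fin 3)), ¬ RegPt n.U y' → tightRate U' y' = levelCrit I ∧
      ∀ ρ : ℝ, 0 < ρ →
        typeIBound (parabolicCylinder ρ (((0 : ℝ), y') : ℝ × (EuclideanSpace ℝ (Fin 3)))) U' P' H' = minLevel I := by
    intro y' hy
    have hyU : ¬ RegPt U' y' := fun hr => hy ((hreg y').1 hr)
    exact ⟨hD.1.tightRate_eq hyU, fun ρ hρ => hD.energy_local_eq hyU hρ⟩
  -- the gallery-minimal rate is `M_c(I)`: read it at the root, an a.e.-invariant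
  have hm0 : tightRate U' 0 = tightRate n.U 0 :=
    tightRate_congr_of_ae_eq_of_norm_lt_one (towerObj_of_abTower hAB).2.1
      (towerObj_of_abTower hn.1).2.1 (fun R hR => hae R hR.1) (by simp)
  have hmc : mstar = levelCrit I := by
    rw [← hsc 0 hn.2, ← hm0]
    exact (hsc' 0 hn.2).1
  exact ⟨n, U', P', H', hn, ht, ⟨L, Ū, hLU, haeU, hny, hsat⟩, hω, hgal, hae, hD,
    hreg, hny, h0', hy', hsc', mstar, hm, hsc, hmc⟩

/-- ★★★ **X3. THE FIXED-POINT CENSUS OF ¬23843 AT THE VIOLATOR'S LEVEL.**  If 23843 fails then, at the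
finite scar-carrying level `I₀` of the violator, EITHER an enveloped rooted A–B object of the critical
class `M_c(I₀)` exists, OR a SELF-DESCENDING, root-recurrent node of the class `M_c(I₀)` exists whose
doubly-minimal representative is saturated in rate AND energy at its root and at its `1/4`-satellite. -/
theorem selfDescending_doublyMin_of_not_scarEnvelopeTypeI
    (h : ¬ Summit.NavierStokesRegularity.NavierStokesRegularity.Theses.TypeIQuarterGate.ScarEnvelopeTypeI) :
    ∃ (M : ℝ) (I₀ : ℝ≥0∞), I₀ < ⊤ ∧ (levelRates I₀).Nonempty ∧ levelCrit I₀ ∈ Icc epsL M ∧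
      minLevel I₀ ≤ I₀ ∧
      ((∃ A : ℝ, EnvelopedLeaf (levelCrit I₀) A) ∨
       ∃ (n : TNode) (U' : ℝ → (EuclideanSpace ℝ (Fin 3)) → (EuclideanSpace ℝ (Fin 3))) (P' : ℝ → (EuclideanSpace ℝ (Fin 3)) → ℝ) (H' : ℝ → (EuclideanSpace ℝ (Fin 3)) → (EuclideanSpace ℝ (Fin 3)) →L[ℝ] (EuclideanSpace ℝ (Fin 3))),
        RootObj (levelCrit I₀) n ∧ ¬ TameRoot n ∧ RootDescends n n ∧ IsRootOmegaLimit n.U n.U ∧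
        (∀ R : ℝ, 0 < R →
          ∀ᵐ z ∂(volume.restrict (parabolicCylinder R (0 : ℝ × (EuclideanSpace ℝ (Fin 3))))), U' z.1 z.2 = n.U z.1 z.2) ∧
        DoublyMin I₀ ⟨U', P', H', n.y⟩ ∧ ‖n.y‖ = 1 / 4 ∧ ¬ RegPt U' 0 ∧ ¬ RegPt U' n.y ∧
        (∀ y' : (EuclideanSpace ℝ (Fin 3)), ¬ RegPt n.U y' → tightRate U' y' = levelCrit I₀ ∧
          ∀ ρ : ℝ, 0 < ρ →
            typeIBound (parabolicCylinder ρ (((0 : ℝ), y') : ℝ × (EuclideanSpace ℝ (Fin 3)))) U' P' H' = minLevel I₀)) := by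
  obtain ⟨M, I₀, hI₀, hne, hIcc, -, -⟩ := exactCritical_of_not_scarEnvelopeTypeI h
  obtain ⟨n₀, hn₀⟩ := doublyMin_nonempty hI₀ hne
  refine ⟨M, I₀, hI₀, hne, hIcc, minLevel_le_self hI₀ hne, ?_⟩
  rcases hn₀.selfDescending_rep with hE |
      ⟨n, U', P', H', hn, ht, hd, hω, -, hae, hD, -, hny, h0, hy, hsc, -⟩
  · exact Or.inl hE
  · exact Or.inr ⟨n, U', P', H', hn, ht, hd, hω, hae, hD, hny, h0, hy, hsc⟩

/-! ### X4. No sup-type Lyapunov functional (ref3 R41 F1, typed) -/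

/-- ★★ **X4. NO STRICT LYAPUNOV FUNCTIONAL OF SUP TYPE ON THE MINIMAL FAMILY.**  Let `Φ` be ANY
`ℝ≥0∞`-valued functional on nodes which, on the doubly-minimal family of the level `I`, is
(i) NON-INCREASING under root blow-ups and (ii) sequentially INF-COMPACT (every sequence in the family
has a member of the family below its `liminf`).  Then `Φ` attains its infimum on the family and is
CONSTANT along every root blow-up (inside the family) of each of its minimisers: `Φ` is NOT a strict
Lyapunov functional of the root descent.  The slab energy `𝐈` (V2 / Part S), the scar rates (T3) and
the envelope constant (U10) are the three instances typed so far; a functional that DROPS along the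
rigid root descent must violate (i) or (ii). -/
theorem DoublyMin.noStrictLyapunov {I : ℝ≥0∞} (Φ : TNode → ℝ≥0∞) (hne : ∃ n : TNode, DoublyMin I n)
    (hmono : ∀ n n' : TNode, DoublyMin I n → DoublyMin I n' → RootBlowup n n' → Φ n' ≤ Φ n)
    (hcpt : ∀ c : ℕ → TNode, (∀ k, DoublyMin I (c k)) →
      ∃ n : TNode, DoublyMin I n ∧ Φ n ≤ liminf (fun k => Φ (c k)) atTop) :
    ∃ n : TNode, DoublyMin I n ∧ (∀ n' : TNode, DoublyMin I n' → Φ n ≤ Φ n') ∧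
      ∀ n' : TNode, DoublyMin I n' → RootBlowup n n' → Φ n' = Φ n := by
  set S : Set ℝ≥0∞ := Φ '' {n | DoublyMin I n} with hS
  have hSne : S.Nonempty := by
    obtain ⟨n, hn⟩ := hne
    exact ⟨Φ n, n, hn, rfl⟩
  obtain ⟨u, -, hu, huS⟩ := exists_seq_tendsto_sInf hSne (OrderBot.bddBelow S)
  choose c hc hcu using huS
  obtain ⟨n, hn, hle⟩ := hcpt c hc
  have hlim : liminf (fun k => Φ (c k)) atTop = sInf S := by
    have e : (fun k => Φ (c k)) = u := funext hcu
    rw [e]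
    exact hu.liminf_eq
  have hmin : ∀ n' : TNode, DoublyMin I n' → Φ n ≤ Φ n' := fun n' hn' =>
    (hle.trans hlim.le).trans (csInf_le (OrderBot.bddBelow S) ⟨n', hn', rfl⟩)
  exact ⟨n, hn, hmin, fun n' hn' hb => le_antisymm (hmono n n' hn hn' hb) (hmin n' hn')⟩

/-- X4 in the wild branch: if no doubly-minimal object of the level is tame, every functional as in X4
has a minimiser `n` AND a doubly-minimal ROOT DESCENDANT `n'` of `n` (U1) with `Φ n' = Φ n` — the root
descent runs inside a level set of `Φ`. -/
theorem DoublyMin.noStrictLyapunov_wild {I : ℝ≥0∞} (Φ : TNode → ℝ≥0∞) (hne : ∃ n : TNode, DoublyMin I n)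
    (hmono : ∀ n n' : TNode, DoublyMin I n → DoublyMin I n' → RootBlowup n n' → Φ n' ≤ Φ n)
    (hcpt : ∀ c : ℕ → TNode, (∀ k, DoublyMin I (c k)) →
      ∃ n : TNode, DoublyMin I n ∧ Φ n ≤ liminf (fun k => Φ (c k)) atTop)
    (hW : ∀ n : TNode, DoublyMin I n → ¬ TameRoot n) :
    ∃ n n' : TNode, DoublyMin I n ∧ DoublyMin I n' ∧ RootDescends n n' ∧
      (∀ n'' : TNode, DoublyMin I n'' → Φ n ≤ Φ n'') ∧ Φ n' = Φ n := by
  obtain ⟨n, hn, hmin, hconst⟩ := DoublyMin.noStrictLyapunov Φ hne hmono hcpt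
  rcases hn.root_step with ht | ⟨n', hn', -, hd⟩
  · exact absurd ht (hW n hn)
  · exact ⟨n, n', hn, hn', hd, hmin, hconst n' hn' hd.rootBlowup⟩

end FixedPoint

end Summit.NavierStokesRegularity.NavierStokesRegularity.Cruxes.ScarEnvelopeTypeI.ZoomDictionary
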